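import Literature.Analysis.FunctionSpaces.FourierSobolevNorm
import HarnessLib

/-!
# Discharged facts of `FourierSobolevNorm`: `f ∈ H^s ↔ ‖f‖_{H^s} < ∞`; `H^s ⊆ Ḣ^s ∩ L²` (`s ≥ 0`)

## 1. `f ∈ H^s ↔ ‖f‖_{H^s} < ∞` for `L²` functions

`Literature.Analysis.FunctionSpaces.FourierSobolevNorm` records as the named fact
`Literature.Analysis.FunctionSpaces.memSobolev_two_iff_eFourierSobolevNorm_lt_top` the bridge between Mathlib's Bessel-potential
Sobolev class `TemperedDistribution.MemSobolev s 2` and the Fourier-side norm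
`Literature.eFourierSobolevNorm s f = (∫ (1 + ‖ξ‖²)^s ‖𝓕f(ξ)‖² dξ)^{1/2}` of an `L²` function `f`
(valued in a complex Hilbert space `F`, on a finite-dimensional real inner product space `E`):
`f ∈ H^s ↔ ‖f‖_{H^s} < ∞`, for every real `s`. This file proves it,
`Literature.Analysis.FunctionSpaces.memSobolev_two_iff_eFourierSobolevNorm_lt_top_holds`.

This is Taylor, *PDE I*, Ch. 4 §1: with `⟨ξ⟩ = (1 + |ξ|²)^{1/2}` (1.3), the space
`H^s(ℝⁿ) = {u ∈ 𝓢'(ℝⁿ) : ⟨ξ⟩^s û ∈ L²(ℝⁿ)}` (1.4) "is equivalent to"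
`H^s(ℝⁿ) = {u ∈ 𝓢'(ℝⁿ) : Λ^s u ∈ L²(ℝⁿ)}` (1.6), where `Λ^s u = 𝓕⁻¹(⟨ξ⟩^s û)` (1.5), with the norm
`‖u‖²_{H^s} = ‖Λ^s u‖²_{L²}` (1.7). Mathlib's `MemSobolev s 2 u` is (1.6) (its `besselPotential` is
`Λ^s`, up to the `2π` normalisation of `𝓕`), and Mathlib's
`TemperedDistribution.memSobolev_iff_exists_smulLeftCLM_fourier` is the equivalence (1.6) ↔ (1.4)
at the level of tempered distributions: `∃ f' ∈ L², ⟨ξ⟩^s • 𝓕u = f'` in `𝓢'`. For `u = f ∈ L²`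
the distribution `𝓕u` *is* the `L²` function `𝓕f` (Plancherel; Mathlib
`MeasureTheory.Lp.fourier_toTemperedDistribution_eq`), and what remains is measure theory:

* `Literature.Analysis.FunctionSpaces.exists_smulLeftCLM_toTemperedDistribution_eq_iff_memLp` — for `g ∈ L²(E; F)` and a real
  weight `w` of temperate growth (here `w = ⟨·⟩^s`), the tempered distribution `w • g` is
  (represented by) an `L²` function iff the *function* `w • g` lies in `L²`. (⇐) is the definition
  of the pairing `⟨w • g, φ⟩ = ⟨g, w φ⟩ = ∫ φ • (w • g)`; (⇒) is the fundamental lemma of the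
  calculus of variations (Mathlib `ae_eq_of_integral_contDiff_smul_eq`): `w • g` is locally
  integrable (continuous times `L²_loc`) and has the same integral against every real `C_c^∞`
  test function as the representing `L²` function, so the two agree a.e.
* `Literature.Analysis.FunctionSpaces.eFourierSobolevNorm_eq_eLpNorm` — `‖f‖_{H^s} = ‖⟨ξ⟩^s 𝓕f‖_{L²}` ((1.7)), as an identity of
  `ℝ≥0∞`-valued quantities (`eLpNorm` of the function `ξ ↦ ⟨ξ⟩^s • 𝓕f(ξ)`), using
  `(⟨ξ⟩^s)² = (1 + ‖ξ‖²)^s`.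

## 2. `‖f‖_{Ḣ^s} ≤ ‖f‖_{H^s}` and `H^s ⊆ Ḣ^s ∩ L²` for `s ≥ 0`

The same file records as named facts `Literature.Analysis.FunctionSpaces.eHomSobolevSeminorm_le` (`‖f‖_{Ḣ^s} ≤ ‖f‖_{H^s}` for
`s ≥ 0` and `f ∈ L²`) and `Literature.Analysis.FunctionSpaces.MemFourierSobolev.memHomSobolev` (`H^s ⊆ Ḣ^s ∩ L²` for `s ≥ 0`,
i.e. `MemFourierSobolev s f → MemHomSobolev s f`), both from Bahouri–Chemin–Danchin, *Fourier
Analysis and Nonlinear PDE* (2011), §1.4.1 (nonhomogeneous spaces `H^s`, weight `(1 + |ξ|²)^s`)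
compared with Def. 1.31 (homogeneous spaces `Ḣ^s`, weight `|ξ|^{2s}`). Section 2 of this file
proves them (`Literature.Analysis.FunctionSpaces.eHomSobolevSeminorm_le_holds`, `Literature.Analysis.FunctionSpaces.MemFourierSobolev.memHomSobolev_holds`).
The whole content is the pointwise comparison of the two Fourier weights,
`|ξ|^{2s} = (|ξ|²)^s ≤ (1 + |ξ|²)^s` for `s ≥ 0` (`Literature.Analysis.FunctionSpaces.enorm_rpow_two_mul_le_ofReal_one_add_sq_rpow`),
integrated against `‖𝓕f(ξ)‖²` (monotonicity of the lower Lebesgue integral), together with the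
identification `‖𝓕f‖_{L²(|ξ|^{2s} dξ)} = ‖f‖_{Ḣ^s}` (`Literature.Analysis.FunctionSpaces.eLpNorm_fourier_homSobolevMeasure`,
Mathlib `lintegral_withDensity_eq_lintegral_mul₀`) and the fact that `𝓕f`, an `L²(dξ)` class, is
a.e. strongly measurable for `|ξ|^{2s} dξ ≪ dξ` (Mathlib `withDensity_absolutelyContinuous`).
The same definitions of `H^s` and `Ḣ^s` by the weights `(1 + |ξ|²)^s` and `|ξ|^{2s}` are in
Lemarié-Rieusset, *The Navier–Stokes Problem in the 21st Century* (2016), §7.2, p. 121.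

## 3. `‖ofFun f hf‖_{Ḣ^s} = ‖f‖_{Ḣ^s}`

The same file records as the named fact `Literature.Analysis.FunctionSpaces.HomSobolev.norm_ofFun`
that the norm, in the bundled space `HomSobolev E F s = L²(‖ξ‖^{2s} dξ)` (Fourier-side
realisation of `Ḣ^s`), of the element `HomSobolev.ofFun f hf` defined by a function
`f ∈ Ḣ^s ∩ L²` is the homogeneous Sobolev seminorm `‖f‖_{Ḣ^s} = (∫ |ξ|^{2s} |𝓕f(ξ)|² dξ)^{1/2}`
of Bahouri–Chemin–Danchin 2011, Def. 1.31. Section 3 proves it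
(`Literature.Analysis.FunctionSpaces.HomSobolev.norm_ofFun_holds`): the norm of an `Lp` class
is the `eLpNorm` of its representative (Mathlib `MeasureTheory.Lp.norm_toLp`), which is
`‖f‖_{Ḣ^s}` by `Literature.Analysis.FunctionSpaces.eLpNorm_fourier_homSobolevMeasure` (§2).

## References

* M. E. Taylor, *Partial Differential Equations I. Basic Theory*, 2nd ed., Applied Mathematical
  Sciences 115, Springer (2011), Ch. 4 §1, (1.3)–(1.7).
* H. Bahouri, J.-Y. Chemin, R. Danchin, *Fourier Analysis and Nonlinear Partial Differential
  Equations*, Grundlehren der mathematischen Wissenschaften 343, Springer (2011), Def. 1.31,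
  §1.4.1.
* P. G. Lemarié-Rieusset, *The Navier–Stokes Problem in the 21st Century*, CRC Press (2016),
  §7.2, p. 121 (definitions of `H^s`, `Ḣ^s` on the Fourier side).
-/

noncomputable section

open MeasureTheory TemperedDistribution ENNReal FourierTransform
open scoped SchwartzMap

namespace Literature.Analysis.FunctionSpaces

variable {E F : Type*} [NormedAddCommGroup E] [InnerProductSpace ℝ E] [FiniteDimensional ℝ E]
  [MeasurableSpace E] [BorelSpace E] [NormedAddCommGroup F] [InnerProductSpace ℂ F]
  [CompleteSpace F]

/-- The pairing of the tempered distribution `w • g` (`g ∈ L²`, `w` a real weight of temperate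
growth, acting through Mathlib's `TemperedDistribution.smulLeftCLM`) with a Schwartz function `u`
is `∫ u • (w • g)`: by definition of the product of a distribution with a temperate function,
`⟨w g, u⟩ = ⟨g, w u⟩ = ∫ (w u) • g`, and the scalars commute pointwise. (Unfolding of Mathlib's
definitions; the multiplication operators `u ↦ ⟨ξ⟩^s û` of Taylor, *PDE I*, Ch. 4 §1 (1.4)–(1.5)
act on `𝓢'` this way.) [folklore] -/
theorem smulLeftCLM_toTemperedDistribution_apply {w : E → ℝ} (hw : w.HasTemperateGrowth)
    (g : Lp F 2 (volume : Measure E)) (u : 𝓢(E, ℂ)) :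
    smulLeftCLM F (fun x ↦ (w x : ℂ)) (g : 𝓢'(E, F)) u =
      ∫ x, u x • (w x • (g : E → F) x) := by
  have hwc : (fun x ↦ (w x : ℂ)).HasTemperateGrowth := by fun_prop
  simp only [smulLeftCLM_apply_apply, Lp.toTemperedDistribution_apply,
    SchwartzMap.smulLeftCLM_apply_apply hwc]
  congr 1 with x
  rw [smul_eq_mul, mul_comm, mul_smul, Complex.coe_smul]

/-- For `g ∈ L²(E; F)` and a real weight `w` of temperate growth, the tempered distribution
`w • g` is represented by an `L²` function iff the function `ξ ↦ w(ξ) • g(ξ)` lies in `L²`.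
With `w = ⟨ξ⟩^s = (1 + |ξ|²)^{s/2}` and `g = û` this is the reading of the condition
"`⟨ξ⟩^s û ∈ L²(ℝⁿ)`" in Taylor, *PDE I*, Ch. 4 §1 (1.4) for `û ∈ L²`: the distributional
product is the pointwise one. (⇐): the pairings agree by definition; (⇒): both `w • g`
(continuous times `L²_loc`, hence locally integrable) and the representing `L²` function have the
same integral against every `C_c^∞` test function, hence agree a.e. (fundamental lemma of the
calculus of variations, Mathlib `ae_eq_of_integral_contDiff_smul_eq`). [cite: TaylorPDEI2011, Ch. 4 §1 (1.4)] -/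
theorem exists_smulLeftCLM_toTemperedDistribution_eq_iff_memLp {w : E → ℝ}
    (hw : w.HasTemperateGrowth) (g : Lp F 2 (volume : Measure E)) :
    (∃ f' : Lp F 2 (volume : Measure E),
        smulLeftCLM F (fun x ↦ (w x : ℂ)) (g : 𝓢'(E, F)) = f') ↔
      MemLp (fun x ↦ w x • (g : E → F) x) 2 (volume : Measure E) := by
  constructor
  · rintro ⟨f', hf'⟩
    have hloc : LocallyIntegrable (fun x ↦ w x • (g : E → F) x) (volume : Measure E) :=
      locallyIntegrableOn_univ.mp <|
        (locallyIntegrableOn_univ.mpr <| (Lp.memLp g).locallyIntegrable one_le_two).continuousOn_smul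
          isOpen_univ.isLocallyClosed hw.1.continuous.continuousOn
    have hae : (fun x ↦ w x • (g : E → F) x) =ᵐ[volume] f' := by
      refine ae_eq_of_integral_contDiff_smul_eq hloc
        ((Lp.memLp f').locallyIntegrable one_le_two) fun φ hφ hφc ↦ ?_
      have hφ₁ : HasCompactSupport (Complex.ofRealCLM ∘ φ) := hφc.comp_left rfl
      have hφ₂ : ContDiff ℝ ((⊤ : ℕ∞) : WithTop ℕ∞) (Complex.ofRealCLM ∘ φ) := by fun_prop
      have hcoe : ∀ x, hφ₁.toSchwartzMap hφ₂ x = (φ x : ℂ) := fun _ ↦ rfl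
      have h := congrArg (fun u : 𝓢'(E, F) ↦ u (hφ₁.toSchwartzMap hφ₂)) hf'
      simp only [smulLeftCLM_toTemperedDistribution_apply hw, Lp.toTemperedDistribution_apply,
        hcoe, Complex.coe_smul] at h
      exact h
    exact (Lp.memLp f').ae_eq hae.symm
  · intro h
    refine ⟨h.toLp _, ?_⟩
    ext u
    rw [smulLeftCLM_toTemperedDistribution_apply hw, Lp.toTemperedDistribution_apply]
    refine integral_congr_ae ?_
    filter_upwards [h.coeFn_toLp] with x hx
    rw [hx]

/-- `‖f‖_{H^s} = ‖⟨ξ⟩^s 𝓕f‖_{L²}`: the Fourier-side `H^s` norm of an `L²` function `f` is the `L²`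
norm (`eLpNorm`, `ℝ≥0∞`-valued) of the function `ξ ↦ (1 + ‖ξ‖²)^{s/2} • 𝓕f(ξ)`, since
`((1 + ‖ξ‖²)^{s/2})² = (1 + ‖ξ‖²)^s` (Taylor, *PDE I*, Ch. 4 §1 (1.7) with (1.3), (1.5):
`‖u‖_{H^s} = ‖Λ^s u‖_{L²} = ‖⟨ξ⟩^s û‖_{L²}` by Plancherel). [cite: TaylorPDEI2011, Ch. 4 §1 (1.7)] -/
theorem eFourierSobolevNorm_eq_eLpNorm (s : ℝ) (f : Lp F 2 (volume : Measure E)) :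
    eFourierSobolevNorm s f =
      eLpNorm (fun ξ ↦ ((1 + ‖ξ‖ ^ 2) ^ (s / 2) : ℝ) •
        ((𝓕 f : Lp F 2 (volume : Measure E)) : E → F) ξ) 2 (volume : Measure E) := by
  rw [eFourierSobolevNorm, eLpNorm_eq_lintegral_rpow_enorm_toReal two_ne_zero ENNReal.ofNat_ne_top]
  simp only [ENNReal.toReal_ofNat, ENNReal.rpow_ofNat, one_div]
  congr 1
  refine lintegral_congr fun ξ ↦ ?_
  have h0 : (0 : ℝ) ≤ (1 + ‖ξ‖ ^ 2) ^ (s / 2) := by positivity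
  have h2 : s / 2 * ((2 : ℕ) : ℝ) = s := by push_cast; ring
  rw [enorm_smul, mul_pow, Real.enorm_eq_ofReal h0, ← ENNReal.ofReal_pow h0,
    ← Real.rpow_mul_natCast (by positivity), h2]

/-- Membership in `H^s` of an `L²` function is finiteness of its Fourier-side `H^s` norm: the
function `ξ ↦ ⟨ξ⟩^s • 𝓕f(ξ)` is a.e. strongly measurable, so it lies in `L²` iff its `eLpNorm`
is finite (Taylor, *PDE I*, Ch. 4 §1 (1.4), (1.7)). [cite: TaylorPDEI2011, Ch. 4 §1 (1.4), (1.7)] -/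
theorem memLp_fourierWeight_smul_iff_eFourierSobolevNorm_lt_top (s : ℝ)
    (f : Lp F 2 (volume : Measure E)) :
    MemLp (fun ξ ↦ ((1 + ‖ξ‖ ^ 2) ^ (s / 2) : ℝ) •
        ((𝓕 f : Lp F 2 (volume : Measure E)) : E → F) ξ) 2 (volume : Measure E) ↔
      eFourierSobolevNorm s f < ∞ := by
  rw [eFourierSobolevNorm_eq_eLpNorm]
  refine ⟨fun h ↦ h.eLpNorm_lt_top, fun h ↦ ⟨?_, h⟩⟩
  exact (Function.hasTemperateGrowth_one_add_norm_sq_rpow E (s / 2)).1.continuous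
    |>.aestronglyMeasurable.fun_smul (Lp.aestronglyMeasurable _)

/-- **Discharge of `memSobolev_two_iff_eFourierSobolevNorm_lt_top`.** An `L²` function `f` lies
in Mathlib's Sobolev class `MemSobolev s 2` (as a tempered distribution; Taylor's (1.6),
`Λ^s f ∈ L²`) iff its Fourier-side `H^s` norm `(∫ (1 + ‖ξ‖²)^s ‖𝓕f(ξ)‖² dξ)^{1/2}` is finite
(Taylor's (1.4), `⟨ξ⟩^s f̂ ∈ L²`, with the norm (1.7)). Taylor, *PDE I*, Ch. 4 §1: "(1.4) is
equivalent to (1.6)". Proof: Mathlib's `memSobolev_iff_exists_smulLeftCLM_fourier` ((1.6) ↔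
`⟨ξ⟩^s • 𝓕f` is an `L²` distribution), `Lp.fourier_toTemperedDistribution_eq` (`𝓕` on `𝓢'`
extends `𝓕` on `L²`), `exists_smulLeftCLM_toTemperedDistribution_eq_iff_memLp` (distributional =
pointwise product) and `eFourierSobolevNorm_eq_eLpNorm`. [cite: TaylorPDEI2011, Ch. 4 §1 (1.4)⇔(1.6)] -/
theorem memSobolev_two_iff_eFourierSobolevNorm_lt_top_holds :
    memSobolev_two_iff_eFourierSobolevNorm_lt_top (E := E) (F := F) := by
  intro s f
  rw [memSobolev_iff_exists_smulLeftCLM_fourier, Lp.fourier_toTemperedDistribution_eq,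
    exists_smulLeftCLM_toTemperedDistribution_eq_iff_memLp
      (Function.hasTemperateGrowth_one_add_norm_sq_rpow E (s / 2)),
    memLp_fourierWeight_smul_iff_eFourierSobolevNorm_lt_top]

/-! ### 2. `‖f‖_{Ḣ^s} ≤ ‖f‖_{H^s}` and `H^s ⊆ Ḣ^s ∩ L²` for `s ≥ 0` -/

omit [InnerProductSpace ℝ E] [FiniteDimensional ℝ E] [MeasurableSpace E] [BorelSpace E] in
/-- Pointwise comparison of the Fourier weights of `Ḣ^s` and `H^s`: `‖ξ‖^{2s} ≤ (1 + ‖ξ‖²)^s`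
for `s ≥ 0` (as `ℝ≥0∞`-valued quantities, `‖ξ‖ₑ ^ (2s)` versus `ofReal ((1 + ‖ξ‖²)^s)`, the
weights appearing in `Literature.Analysis.FunctionSpaces.eHomSobolevSeminorm` and `Literature.Analysis.FunctionSpaces.eFourierSobolevNorm`), because
`‖ξ‖^{2s} = (‖ξ‖²)^s` and `t ↦ t^s` is monotone on `[0, ∞)` for `s ≥ 0`. Elementary; it is the
inequality behind `H^s ⊆ Ḣ^s` for `s ≥ 0`. [folklore] -/
theorem enorm_rpow_two_mul_le_ofReal_one_add_sq_rpow {s : ℝ} (hs : 0 ≤ s) (ξ : E) :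
    ‖ξ‖ₑ ^ (2 * s) ≤ ENNReal.ofReal ((1 + ‖ξ‖ ^ 2) ^ s) := by
  rw [← ofReal_norm, ENNReal.ofReal_rpow_of_nonneg (norm_nonneg _) (by positivity),
    Real.rpow_mul (norm_nonneg _), Real.rpow_two]
  exact ENNReal.ofReal_le_ofReal
    (Real.rpow_le_rpow (sq_nonneg _) (le_add_of_nonneg_left zero_le_one) hs)

/-- The `L²(‖ξ‖^{2s} dξ)` norm (`eLpNorm` for the weight measure `homSobolevMeasure E s`) of (the
chosen representative of) `𝓕f`, `f ∈ L²`, *is* the homogeneous Sobolev seminorm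
`‖f‖_{Ḣ^s} = (∫ ‖ξ‖^{2s} ‖𝓕f(ξ)‖² dξ)^{1/2}` of Bahouri–Chemin–Danchin 2011, Def. 1.31: both
sides unfold to the same lower Lebesgue integral (Mathlib `lintegral_withDensity_eq_lintegral_mul₀`;
`𝓕f` is a.e. strongly measurable for `dξ`). This identifies the norm of the bundled space
`HomSobolev E F s = L²(‖ξ‖^{2s} dξ)` with `eHomSobolevSeminorm`. [cite: BahouriCheminDanchin2011, Def. 1.31] -/
theorem eLpNorm_fourier_homSobolevMeasure (s : ℝ) (f : Lp F 2 (volume : Measure E)) :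
    eLpNorm ((𝓕 f : Lp F 2 (volume : Measure E)) : E → F) 2 (homSobolevMeasure E s) =
      eHomSobolevSeminorm s f := by
  rw [homSobolevMeasure, eLpNorm_eq_lintegral_rpow_enorm_toReal two_ne_zero ENNReal.ofNat_ne_top,
    lintegral_withDensity_eq_lintegral_mul₀ (by fun_prop)
      ((Lp.aestronglyMeasurable _).enorm.pow_const _), eHomSobolevSeminorm]
  simp only [ENNReal.toReal_ofNat, Pi.mul_apply, ENNReal.rpow_ofNat]

/-- **Discharge of `eHomSobolevSeminorm_le`.** `‖f‖_{Ḣ^s} ≤ ‖f‖_{H^s}` for `s ≥ 0` and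
`f ∈ L²`, i.e. `(∫ ‖ξ‖^{2s} ‖𝓕f‖² dξ)^{1/2} ≤ (∫ (1 + ‖ξ‖²)^s ‖𝓕f‖² dξ)^{1/2}`
(Bahouri–Chemin–Danchin 2011, §1.4.1: for nonnegative `s` the nonhomogeneous space `H^s`,
weight `(1 + |ξ|²)^s`, is contained in the homogeneous space `Ḣ^s` of Def. 1.31, weight
`|ξ|^{2s}`). Proof: integrate the pointwise weight comparison
`enorm_rpow_two_mul_le_ofReal_one_add_sq_rpow` (monotonicity of `∫⁻` and of `t ↦ t^{1/2}`). [cite: BahouriCheminDanchin2011, §1.4.1] -/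
theorem eHomSobolevSeminorm_le_holds : eHomSobolevSeminorm_le (E := E) (F := F) := by
  intro s hs f
  unfold eHomSobolevSeminorm eFourierSobolevNorm
  gcongr with ξ
  exact enorm_rpow_two_mul_le_ofReal_one_add_sq_rpow hs ξ

/-- **Discharge of `MemFourierSobolev.memHomSobolev`.** `H^s ⊆ Ḣ^s ∩ L²` for `s ≥ 0`
(Bahouri–Chemin–Danchin 2011, §1.4.1): if `f ∈ L²` and `∫ (1 + ‖ξ‖²)^s ‖𝓕f(ξ)‖² dξ < ∞`
(`MemFourierSobolev s f`), then `𝓕f ∈ L²(‖ξ‖^{2s} dξ)` (`MemHomSobolev s f`, with the same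
`L²` witness). Proof: `𝓕f`, an `L²(dξ)` class, is a.e. strongly measurable for `‖ξ‖^{2s} dξ`
because `‖ξ‖^{2s} dξ ≪ dξ` (Mathlib `withDensity_absolutelyContinuous`), and its
`L²(‖ξ‖^{2s} dξ)` norm is `‖f‖_{Ḣ^s} ≤ ‖f‖_{H^s} < ∞` by `eLpNorm_fourier_homSobolevMeasure` and
`eHomSobolevSeminorm_le_holds`. [cite: BahouriCheminDanchin2011, §1.4.1] -/
theorem MemFourierSobolev.memHomSobolev_holds :
    MemFourierSobolev.memHomSobolev (E := E) (F := F) := by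
  intro s hs f hf
  obtain ⟨h, hfin⟩ := hf
  refine ⟨h, (Lp.aestronglyMeasurable _).mono_ac (withDensity_absolutelyContinuous _ _), ?_⟩
  rw [eLpNorm_fourier_homSobolevMeasure]
  exact (eHomSobolevSeminorm_le_holds hs _).trans_lt hfin

/-! ## 3. The `Ḣ^s` norm of `HomSobolev.ofFun f hf` -/

namespace HomSobolev

/-- **Discharge of `HomSobolev.norm_ofFun`.** The `Ḣ^s` norm of the element `ofFun f hf` of the
bundled space `HomSobolev E F s = L²(‖ξ‖^{2s} dξ)` defined by a function `f ∈ Ḣ^s ∩ L²` is the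
homogeneous Sobolev seminorm `‖f‖_{Ḣ^s} = (∫ ‖ξ‖^{2s} ‖𝓕f(ξ)‖² dξ)^{1/2}` of `f`
(Bahouri–Chemin–Danchin 2011, Def. 1.31: `‖u‖²_{Ḣ^s} = ∫ |ξ|^{2s} |û(ξ)|² dξ`). Proof: `ofFun f hf`
is the `L²(‖ξ‖^{2s} dξ)` class of `𝓕f`, whose norm is `(eLpNorm 𝓕f 2 (‖ξ‖^{2s} dξ)).toReal`
(Mathlib `MeasureTheory.Lp.norm_toLp`), and that `eLpNorm` is `‖f‖_{Ḣ^s}`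
(`eLpNorm_fourier_homSobolevMeasure`); the function-level seminorm `Function.eHomSobolevSeminorm`
takes its `L²` branch at the witness `hf.choose : MemLp f 2`. [cite: BahouriCheminDanchin2011, Def. 1.31] -/
theorem norm_ofFun_holds {s : ℝ} : norm_ofFun (E := E) (F := F) (s := s) := by
  intro f hf
  change ‖hf.choose_spec.toLp _‖ = _
  rw [Lp.norm_toLp, eLpNorm_fourier_homSobolevMeasure, Function.eHomSobolevSeminorm,
    dif_pos hf.choose]

end HomSobolev

end Literature.Analysis.FunctionSpaces
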